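import Summits.HodgeConjecture.HodgeConjecture.Theorems.F0P2oSupercuspidalNeConstituent      -- ★ `not_isConstituentOf_cmPrincipalSeries_of_isSupercuspidal'` (letter-free ED. 2), `stubSupercuspidalNeConstituent_holds`
import Summits.HodgeConjecture.HodgeConjecture.Theorems.F0P3bLocalNonsplitCompactCenter        -- ★ p825600 `local_nonsplit_compactOpen_center_of_center_le` (compact centre of `U(Φ₃)(L⁺_v)` at a non-split `v`)
import Literature.NumberTheory.Automorphic.LocalUnitaryGroupCenter                               -- ★ `forall_mem_center_cmLocal_eq_scalar`
import Literature.NumberTheory.Automorphic.LocalUnitaryGroupCongr                                -- ★ `antidiagOne_isHermitian`, `isUnit_antidiagOne_det`, `cmDatumLocalCongr`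
import Literature.NumberTheory.Rogawski1990.SupercuspidalNotSphericalCofinite                    -- ★ `IrrClass.isSupercuspidal_comap_iff`, `IrrClass.not_isSupercuspidal_of_not_isSquareIntegrable`
import Literature.NumberTheory.Rogawski1990.CMLocalAPacketMembers                                -- ★ `KeysCaseTwoLabels`, `Gqs`, `qsForm`
import HarnessLib

/-!
# F0 · P3c · line LH6 «StCharTS» — ORGAN «NE»: the supercuspidal companion `πˢ` of [Rogawski1990, L.12.7.3] is NEITHER of the transported
# Keys labels `π²(ξ_v)∘e⁻¹`, `πⁿ(ξ_v)∘e⁻¹` (the `πs ≠ comap e⁻¹ πn` conjunct of the closer row `stub_StCharTS` ∕ (N-1273S))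

Cell `pub/hodgecm-mathlib`, crux H413 = `stmt-HodgeConjecture-24833` (lane `--supports`), route HCCMUnconditional; seat LH6-p02 (g0), DEFAULT organ named on the
squad bus 2026-09-02 (desk F0P3b-plan (g23) line LH6).  THEOREMS ONLY, sorry-free, no definition ∕ instance ∕ notation ∕ named fact.
HONEST LABEL: HC_CM is proved only modulo the printed citations (2 remaining named inputs hLiu418 24832, h413 24833) until rung 0 closes; this file proves
no letter — it discharges the DISTINCTNESS conjunct `πs ≠ IrrClass.comap (cmDatumLocalCongr L v T ha h).symm πn` of the (N-1273S) text from
«`πs` supercuspidal» alone, so that any pay-down of [L.12.7.3] producing a SUPERCUSPIDAL `πs` with the character identity closes that conjunct BY NAME.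

THE MATHEMATICS ([Rogawski1990, §12.2 p. 173 first sentence; (2) p. 174; §12.7 L.12.7.3 p. 188; §13.1 Prop. 13.1.3 (d) p. 199]).  At a finite place `v` of `L⁺`
NOT split in `L`, with `G = U(Φ₃)(L⁺_v)` (★ `Gqs L v`) and the Keys labels `(π², πⁿ)` of `JH(i_G(χ_ξ))` (★ `KeysCaseTwoLabels`: BOTH labels are constituents of the
principal series ★ `cmPrincipalSeries L 3 v (cmXiTorusChar …)`), NO supercuspidal class of the inner form `U(H)(L⁺_v)` is the transport `comap e⁻¹ π²` or
`comap e⁻¹ πⁿ` along the form congruence `e = cmDatumLocalCongr L v T ha h` — transport preserves supercuspidality (★ `IrrClass.isSupercuspidal_comap_iff`) and a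
supercuspidal class is never a constituent of `i_G(χ)` (★ `F0P2oSupercuspidalNeConstituent.not_isConstituentOf_cmPrincipalSeries_of_isSupercuspidal'`, Harish-Chandra's
criterion ⇒ half ★ + projectivity of compact representations).  §2 gives the measure-theoretic twin used by the letter's `¬ πn.IsSquareIntegrable μZ` label:
the centre `E¹_v · 1` of `U(Φ₃)(L⁺_v)` is COMPACT at a non-split `v` (★ `F0P3bLocalNonsplitCompactCenter.local_nonsplit_compactOpen_center_of_center_le` + ★ `forall_mem_center_cmLocal_eq_scalar`), so a class that
is not square-integrable modulo the centre is not supercuspidal (★ `IrrClass.not_isSupercuspidal_of_not_isSquareIntegrable`), hence is not `comap e πs`.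

## References
* [Rogawski1990] J. D. Rogawski, *Automorphic Representations of Unitary Groups in Three Variables*, Ann. of Math. Stud. 123 (1990): §12.2 pp. 173–174;
  §12.7 Lemma 12.7.3, Cor. 12.7.4 p. 188; §13.1 Prop. 13.1.3 (d) p. 199.
* [HarishChandra1970] Harish-Chandra (notes by G. van Dijk), *Harmonic Analysis on Reductive p-adic Groups*, LNM 162 (1970), Part I §3 p. 9.
* [Casselman1995] W. Casselman, *Introduction to the theory of admissible representations of p-adic reductive groups* (1995), Thm. 5.3.1.
-/

set_option autoImplicit false
-- the mandated namespace has the single-problem summit's repeated segment (`HodgeConjecture.HodgeConjecture`)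
set_option linter.dupNamespace false

noncomputable section

open NumberField IsDedekindDomain MeasureTheory
open scoped Matrix

open Literature.NumberTheory Literature.NumberTheory.Automorphic Literature.NumberTheory.Automorphic.UnitaryGroup
open Literature.NumberTheory.GaloisRepresentations
open Literature.NumberTheory.Rogawski1990

namespace Summit.HodgeConjecture.HodgeConjecture.Cruxes.H413.F0P3cStCharTSNe

variable (L : Type) [Field L] [NumberField L] [IsCMField L]

/-! ## §1 Via the Jordan–Hölder labels: a supercuspidal class of `U(H)(L⁺_v)` is neither transported Keys label -/

/-- **ORGAN «NE» (labels form).**  At a NON-SPLIT finite place `v`, for a form congruence `ᵗT̄ H_v T = a Φ₃` and Keys labels `(π², πⁿ)` of `JH(i_G(χ_ξ))`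
(★ `KeysCaseTwoLabels L v μ η₁ η₂ π2 πn`), every SUPERCUSPIDAL class `πs` of `U(H)(L⁺_v)` differs from BOTH transports `comap e⁻¹ πⁿ` and `comap e⁻¹ π²`
(`e = cmDatumLocalCongr L v T ha h`): both labels are constituents of `i_G(χ_ξ)` and no supercuspidal class is (★ `stubSupercuspidalNeConstituent_holds`).
[cite: Rogawski1990, §12.2 pp. 173–174; §12.7 Lemma 12.7.3 p. 188; §13.1 Prop. 13.1.3 (d) p. 199] -/
theorem ne_comap_keysLabels_of_isSupercuspidal (H : Matrix (Fin 3) (Fin 3) L) (v : HeightOneSpectrum (𝓞 ↥(maximalRealSubfield L)))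
    (hns : ∀ w : PlacesOver L v, IsCMField.complexConj L • w.1 = w.1)
    (T : GL (Fin 3) (UnitaryGroup.LocalRing L v)) (a : UnitaryGroup.LocalRing L v) (ha : IsUnit a)
    (h : formCongr (conjLocal L (IsCMField.complexConj L) v) T (H.map (algebraMap L (UnitaryGroup.LocalRing L v))) =
      a • (Matrix.of fun i j : Fin 3 => if i.val + j.val + 1 = 3 then (1 : L) else 0).map (algebraMap L (UnitaryGroup.LocalRing L v)))
    (μ : (UnitaryGroup.LocalRing L v)ˣ →* ℂˣ) (η₁ η₂ : ↥(normOneUnits (conjLocal L (IsCMField.complexConj L) v)) →* ℂˣ)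
    (π2 πn : IrrClass (Gqs L v)) (hK : KeysCaseTwoLabels L v μ η₁ η₂ π2 πn)
    (πs : IrrClass ((cmDatum L 3 H).Local v)) (hsc : πs.IsSupercuspidal) :
    πs ≠ IrrClass.comap (cmDatumLocalCongr L v T ha h).symm πn ∧ πs ≠ IrrClass.comap (cmDatumLocalCongr L v T ha h).symm π2 :=
  ⟨F0P2oSupercuspidalNeConstituent.stubSupercuspidalNeConstituent_holds L H v hns T a ha h (cmXiTorusChar L v μ η₁ η₂) πn
      ((hK.2 πn).2 (Or.inl rfl)) πs hsc,
    F0P2oSupercuspidalNeConstituent.stubSupercuspidalNeConstituent_holds L H v hns T a ha h (cmXiTorusChar L v μ η₁ η₂) π2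
      ((hK.2 π2).2 (Or.inr rfl)) πs hsc⟩

/-- **ORGAN «NE», the `πⁿ` half in the letter's binder order** (the conjunct `πs ≠ IrrClass.comap (cmDatumLocalCongr L v T ha h).symm πn` of the closer row
`stub_StCharTS` ∕ CMTest `stub_steinbergCharTransferSigned`, from «`πs` supercuspidal» and the Keys labels alone).
[cite: Rogawski1990, §12.7 Lemma 12.7.3 p. 188; §12.2 pp. 173–174] -/
theorem ne_comap_πn_of_isSupercuspidal (H : Matrix (Fin 3) (Fin 3) L) (v : HeightOneSpectrum (𝓞 ↥(maximalRealSubfield L)))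
    (hns : ∀ w : PlacesOver L v, IsCMField.complexConj L • w.1 = w.1)
    (T : GL (Fin 3) (UnitaryGroup.LocalRing L v)) (a : UnitaryGroup.LocalRing L v) (ha : IsUnit a)
    (h : formCongr (conjLocal L (IsCMField.complexConj L) v) T (H.map (algebraMap L (UnitaryGroup.LocalRing L v))) =
      a • (Matrix.of fun i j : Fin 3 => if i.val + j.val + 1 = 3 then (1 : L) else 0).map (algebraMap L (UnitaryGroup.LocalRing L v)))
    (μ : (UnitaryGroup.LocalRing L v)ˣ →* ℂˣ) (η₁ η₂ : ↥(normOneUnits (conjLocal L (IsCMField.complexConj L) v)) →* ℂˣ)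
    (π2 πn : IrrClass (Gqs L v)) (hK : KeysCaseTwoLabels L v μ η₁ η₂ π2 πn)
    (πs : IrrClass ((cmDatum L 3 H).Local v)) (hsc : πs.IsSupercuspidal) :
    πs ≠ IrrClass.comap (cmDatumLocalCongr L v T ha h).symm πn :=
  (ne_comap_keysLabels_of_isSupercuspidal L H v hns T a ha h μ η₁ η₂ π2 πn hK πs hsc).1

/-! ## §2 Via square-integrability: the centre of `U(Φ₃)(L⁺_v)` is compact at a non-split `v` -/

set_option synthInstance.maxHeartbeats 400000 in
/-- **A class of `U(Φ₃)(L⁺_v)` (non-split `v`) that is NOT square-integrable modulo the centre is not supercuspidal** — compact centre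
(★ `local_nonsplit_compactOpen_center_of_center_le`, central elements are scalars ★ `forall_mem_center_cmLocal_eq_scalar`) + ★
`IrrClass.not_isSupercuspidal_of_not_isSquareIntegrable`; e.g. the Keys label `πⁿ(ξ_v)` of the (N-1273S) letter.
[cite: Rogawski1990, §12.2 (2) pp. 173–174; §13.1 Prop. 13.1.3 (d) p. 199] [cite: HarishChandra1970, Part I §3 p. 9] -/
theorem not_isSupercuspidal_of_not_isSquareIntegrable_gqs (v : HeightOneSpectrum (𝓞 ↥(maximalRealSubfield L)))
    (hns : ∀ w : PlacesOver L v, IsCMField.complexConj L • w.1 = w.1)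
    [MeasurableSpace (Gqs L v ⧸ Subgroup.center (Gqs L v))]
    (μZ : Measure (Gqs L v ⧸ Subgroup.center (Gqs L v))) [μZ.IsHaarMeasure]
    {πn : IrrClass (Gqs L v)} (hL2 : ¬ πn.IsSquareIntegrable μZ) : ¬ πn.IsSupercuspidal := by
  -- the centre `E¹_v · 1` of `U(Φ₃)(L⁺_v)` is compact at the non-split `v` (spelled on the `AdelicGroupData` carrier `Gqs L v`)
  have hZ : IsCompact ((Subgroup.center (Gqs L v) : Subgroup (Gqs L v)) : Set (Gqs L v)) :=
    (F0P3bLocalNonsplitCompactCenter.local_nonsplit_compactOpen_center_of_center_le L 3 (qsForm L) (isUnit_antidiagOne_det L 3) v hns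
      (forall_mem_center_cmLocal_eq_scalar L (qsForm L) (antidiagOne_isHermitian L 3) (isUnit_antidiagOne_det L 3) v hns)).2
  exact IrrClass.not_isSupercuspidal_of_not_isSquareIntegrable μZ hZ hL2

set_option synthInstance.maxHeartbeats 400000 in
/-- **ORGAN «NE» (square-integrability form).**  At a non-split `v`, a SUPERCUSPIDAL class `πs` of `U(H)(L⁺_v)` is not the transport `comap e⁻¹ πn` of a
class `πn` of `U(Φ₃)(L⁺_v)` that is NOT square-integrable modulo the (compact) centre — the letter's label `¬ πn.IsSquareIntegrable μZ` — for ANY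
`e : U(H)(L⁺_v) ≃ₜ* U(Φ₃)(L⁺_v)` (transport of supercuspidality ★ `IrrClass.isSupercuspidal_comap_iff`).
[cite: Rogawski1990, §12.7 Lemma 12.7.3 p. 188; §12.2 (2) pp. 173–174] [cite: HarishChandra1970, Part I §3 p. 9] -/
theorem ne_comap_of_isSupercuspidal_of_not_isSquareIntegrable (H : Matrix (Fin 3) (Fin 3) L)
    (v : HeightOneSpectrum (𝓞 ↥(maximalRealSubfield L))) (hns : ∀ w : PlacesOver L v, IsCMField.complexConj L • w.1 = w.1)
    (e : (cmDatum L 3 H).Local v ≃ₜ* Gqs L v)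
    [MeasurableSpace (Gqs L v ⧸ Subgroup.center (Gqs L v))]
    (μZ : Measure (Gqs L v ⧸ Subgroup.center (Gqs L v))) [μZ.IsHaarMeasure]
    (πn : IrrClass (Gqs L v)) (hL2 : ¬ πn.IsSquareIntegrable μZ)
    (πs : IrrClass ((cmDatum L 3 H).Local v)) (hsc : πs.IsSupercuspidal) :
    πs ≠ IrrClass.comap e πn := by
  intro heq
  subst heq
  exact not_isSupercuspidal_of_not_isSquareIntegrable_gqs L v hns μZ hL2 ((IrrClass.isSupercuspidal_comap_iff e πn).1 hsc)

end Summit.HodgeConjecture.HodgeConjecture.Cruxes.H413.F0P3cStCharTSNe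

end
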